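import Mathlib

/-!
# K1 wild orbit: the E-face `x² + y·z⁴ + y⁷·u⁴` keeps a non-zero `z⁴`-coefficient on every smooth hypersurface `x = φ(u,z)`
  (res-L1-w43-tri-1, TRIAGE v9.7 §21.15 (D)/(E); kernel anchor for the re-qualification of K4.3)

[OURS · L1 W4.3 · crux `WeightedConstruction` (stmt-0571) / door `HypersurfaceCentreConstruction` (stmt-19897) · small-model facts,
def-free; AI-written, weaker than expert review; no statement of the manuscript under review is used or formalised.]

Setting (hand, §21.15 (D)): Hauser's start `K1 = x² + y⁷ + y·z⁴` over `𝔽₂` under the EXACT σ-weights `(5,2,2)`; in the `u`-chart the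
strict transform is `g = x² + y·z⁴ + y⁷·u⁴` (for the isolated variant `K1′ = K1 + z⁹` add `u⁸·z⁹`), and the only order-2 successor orbit is
the `μ₂`-orbit `𝔫 = (u, x, z)` with residue field `κ(𝔫) = k(y)`, in which `y` is a unit and NOT A SQUARE.  The contact slope at `B_𝔫` is
bounded by `a₂ ≤ ord (g mod g₁)` for every flag `(g₁; g₂)`; when the linear part of `g₁` involves `x`, `B̂_𝔫/(g₁) ≅ κ⟦u, z⟧` with
`x ≡ φ(u, z)` and `g mod g₁ = φ² + y·z⁴ + y⁷·u⁴ (+ ρ, ρ ∈ (u, z)⁵)`.  THIS FILE: in characteristic 2 the `z⁴`-coefficient of that series is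
`(coeff_{z²} φ)² + y` (`face_coeff`), hence NON-ZERO whenever `y` is not a square (`face_coeff_ne_zero`) — so `ord (g mod g₁) ≤ 4` and
`a₂(B_𝔫) ≤ 4 < 5 = a₂(K1)`: the σ-letter DROPS at the wild orbit (`5/2 → 2`), and the loop recorded as «K4.3 dead» is an artefact of the
pointwise/sliced reading at the closed `μ₂`-point.  Model of the residue coefficient: `y = X ∈ 𝔽₂[X]` is not a square (`not_isSquare_X`),
giving the concrete instance `k1_face_coeff_ne_zero`.  Variables: index `0 = z`, index `1 = u` of `MvPowerSeries (Fin 2) R`.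

Contents: `coeff_add_self_sq` (char 2: `coeff (m+m) (φ²) = (coeff m φ)²`, by the swap involution on the antidiagonal) ·
`face_coeff` · `face_coeff_ne_zero` · `not_isSquare_X` · `k1_face_coeff_ne_zero`.  [folklore]-level algebra throughout.
-/

set_option linter.dupNamespace false

namespace Summit.ResolutionOfSingularities.ResolutionOfSingularities.Theorems.WeightedConstruction.Negative.K1WildOrbitFace

open MvPowerSeries Finsupp

/-- In characteristic `2`, the coefficient of `X^{m+m}` in `φ²` is the square of the coefficient of `X^m` in `φ`
(the off-diagonal terms of the Cauchy product cancel in pairs under the swap involution). [folklore] -/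
theorem coeff_add_self_sq {σ R : Type*} [CommRing R] [CharP R 2] (φ : MvPowerSeries σ R) (m : σ →₀ ℕ) :
    coeff (m + m) (φ ^ 2) = (coeff m φ) ^ 2 := by
  classical
  rw [sq, sq, coeff_mul, ← Finset.sum_filter_add_sum_filter_not _ (fun ij : (σ →₀ ℕ) × (σ →₀ ℕ) => ij.1 = ij.2)]
  have hdiag : (Finset.HasAntidiagonal.antidiagonal (m + m)).filter
      (fun ij : (σ →₀ ℕ) × (σ →₀ ℕ) => ij.1 = ij.2) = {(m, m)} := by
    ext ⟨i, j⟩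
    simp only [Finset.mem_filter, Finset.HasAntidiagonal.mem_antidiagonal, Finset.mem_singleton, Prod.mk.injEq]
    constructor
    · rintro ⟨hij, rfl⟩
      have hi : i = m := by
        ext s
        have hs := congrArg (fun f : σ →₀ ℕ => f s) hij
        simp only [Finsupp.coe_add, Pi.add_apply] at hs
        omega
      exact ⟨hi, hi⟩
    · rintro ⟨rfl, rfl⟩
      exact ⟨rfl, rfl⟩
  have hoff : ∑ ij ∈ (Finset.HasAntidiagonal.antidiagonal (m + m)).filter
      (fun ij : (σ →₀ ℕ) × (σ →₀ ℕ) => ¬ ij.1 = ij.2), coeff ij.1 φ * coeff ij.2 φ = 0 := by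
    refine Finset.sum_involution (fun ij _ => (ij.2, ij.1)) ?_ ?_ ?_ ?_
    · intro ij _
      rw [mul_comm (coeff ij.2 φ)]
      exact CharTwo.add_self_eq_zero _
    · intro ij hij _ h
      simp only [Finset.mem_filter] at hij
      exact hij.2 (congrArg Prod.snd h : ij.1 = ij.2)
    · intro ij hij
      simp only [Finset.mem_filter, Finset.HasAntidiagonal.mem_antidiagonal] at hij ⊢
      exact ⟨by rw [add_comm]; exact hij.1, fun h => hij.2 h.symm⟩
    · intro ij _
      rfl
  rw [hdiag, Finset.sum_singleton, hoff, add_zero]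

/-- **The `z⁴`-coefficient of the K1 face on the hypersurface `x = φ(u,z)`** (char 2): for every power series `φ` and every
remainder `ρ` without `z⁴`-term, `coeff_{z⁴} (φ² + y·z⁴ + y⁷·u⁴ + ρ) = (coeff_{z²} φ)² + y`. [folklore] -/
theorem face_coeff {R : Type*} [CommRing R] [CharP R 2] (y : R) (φ ρ : MvPowerSeries (Fin 2) R)
    (hρ : coeff (single 0 4) ρ = 0) :
    coeff (single 0 4) (φ ^ 2 + C y * X 0 ^ 4 + C (y ^ 7) * X 1 ^ 4 + ρ) = (coeff (single 0 2) φ) ^ 2 + y := by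
  have h1 : coeff (single 0 4) (φ ^ 2) = (coeff (single 0 2) φ) ^ 2 := by
    rw [show (single 0 4 : Fin 2 →₀ ℕ) = single 0 2 + single 0 2 by rw [← Finsupp.single_add]]
    exact coeff_add_self_sq φ _
  have h01 : (single 0 4 : Fin 2 →₀ ℕ) ≠ single 1 4 := by
    rw [Ne, Finsupp.single_left_inj (by norm_num)]
    decide
  simp only [map_add, coeff_C_mul, coeff_X_pow, if_true, if_neg h01, h1, hρ, mul_one, mul_zero, add_zero]

/-- **Slope obstruction at the wild orbit.** If `y` is not a square (in characteristic 2), the `z⁴`-coefficient of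
`φ² + y·z⁴ + y⁷·u⁴ + ρ` is non-zero for EVERY `φ` — so `ord (g mod g₁) ≤ 4` on every smooth hypersurface `x = φ(u,z)` through the
orbit-generic point, whence `a₂(B_𝔫) ≤ 4 < 5` (§21.15 (D)). [folklore] -/
theorem face_coeff_ne_zero {R : Type*} [CommRing R] [CharP R 2] {y : R} (hy : ¬ IsSquare y) (φ ρ : MvPowerSeries (Fin 2) R)
    (hρ : coeff (single 0 4) ρ = 0) :
    coeff (single 0 4) (φ ^ 2 + C y * X 0 ^ 4 + C (y ^ 7) * X 1 ^ 4 + ρ) ≠ 0 := by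
  rw [face_coeff y φ ρ hρ]
  intro h
  apply hy
  refine ⟨coeff (single 0 2) φ, ?_⟩
  have h' : y = -((coeff (single 0 2) φ) ^ 2) := (add_eq_zero_iff_neg_eq.mp h).symm
  rw [h', CharTwo.neg_eq, sq]

/-- The residue coefficient of record: `y = X ∈ 𝔽₂[X]` (the orbit coordinate, a polynomial variable over the prime field) is not a
square. [folklore] -/
theorem not_isSquare_X : ¬ IsSquare (Polynomial.X : Polynomial (ZMod 2)) := by
  haveI : Fact (Nat.Prime 2) := ⟨Nat.prime_two⟩
  rintro ⟨q, hq⟩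
  have hq0 : q ≠ 0 := by
    rintro rfl
    simp at hq
  have hdeg := congrArg Polynomial.natDegree hq
  rw [Polynomial.natDegree_X, Polynomial.natDegree_mul hq0 hq0] at hdeg
  omega

/-- **K1 / K1′ at the `μ₂`-orbit, concrete instance** over the coefficient ring `𝔽₂[y]` (`y = X`): for every `φ` and every remainder `ρ`
without `z⁴`-term (e.g. `ρ = u⁸·z⁹` for `K1′`), the `z⁴`-coefficient of `φ² + y·z⁴ + y⁷·u⁴ + ρ` is non-zero. [folklore] -/
theorem k1_face_coeff_ne_zero (φ ρ : MvPowerSeries (Fin 2) (Polynomial (ZMod 2))) (hρ : coeff (single 0 4) ρ = 0) :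
    coeff (single 0 4) (φ ^ 2 + C Polynomial.X * X 0 ^ 4 + C (Polynomial.X ^ 7) * X 1 ^ 4 + ρ) ≠ 0 :=
  face_coeff_ne_zero not_isSquare_X φ ρ hρ

/-- The `K1′` remainder `u⁸·z⁹` has no `z⁴`-term. [folklore] -/
theorem coeff_z4_u8z9 {R : Type*} [CommRing R] :
    coeff (single 0 4) ((X 1 : MvPowerSeries (Fin 2) R) ^ 8 * X 0 ^ 9) = 0 := by
  rw [show ((X 1 : MvPowerSeries (Fin 2) R) ^ 8 * X 0 ^ 9) =
      monomial (single 1 8 + single 0 9) 1 by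
    rw [X_pow_eq, X_pow_eq, monomial_mul_monomial, mul_one]]
  rw [coeff_monomial, if_neg]
  intro h
  have := congrArg (fun f : Fin 2 →₀ ℕ => f 0) h
  simp at this

end Summit.ResolutionOfSingularities.ResolutionOfSingularities.Theorems.WeightedConstruction.Negative.K1WildOrbitFace
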